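import Summits.ABC.IUTFork.ForkThm110
import Literature.IUT.LogVolume.Theorem110
import HarnessLib

/-!
# The fork at [IUTchIII] Corollary 3.12 — bridge: the skeleton's `MultiradialEstimate` is the OUTPUT of
# [IUTchIV] Theorem 1.10, Steps (i)–(viii), from named finer inputs

Record-only file (D-0012) of the abc-iut cell; TAKES NO SIDE. The fork skeleton
(`Summits/ABC/IUTFork/ForkThm110.lean`) types, for one elliptic curve in initial Θ-data, the real numbers
of [IUTchIV] Theorem 1.10 (`Thm110Data`) with TWO hypotheses never asserted: `MultiradialEstimate`
("`−|log(Θ)| ≤ C_Θ·|log(q)|`" for the printed `C_Θ`) and `Cor312` ("`−|log(q)| ≤ −|log(Θ)|`"), and proves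
`display_of_cor312 : MultiradialEstimate → Cor312 → Display`. The Literature files
`Literature/IUT/LogVolume/Theorem110Data.lean` + `Theorem110.lean` PROVE the arithmetic Steps (i)–(iii),
(viii) of the printed proof (pp. 23–31) from `Thm110Numerics.ProofData` — the printed intermediate
inequalities that the arithmetic consumes (log-volume content of Steps (iv)–(vii) = field `hull_le`;
Prop. 1.3/1.8-based inequalities of Steps (ii)–(iii)) — and the prime number theorem (Prop. 1.6, PROVED in
the tree: `Literature.IUT.LogVolume.exists_isEtaPrm`).

This file connects the two: `toThm110Data` sends Literature numerics to the skeleton's data (with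
`logdf := log(𝔡^{F_tpd}) + log(𝔣^{F_tpd})`, `e*_mod` cast to `ℝ`, `η := η_prm`), and
* `multiradialEstimate_iff` — the skeleton's `MultiradialEstimate` is LITERALLY `CThetaAdmissible`;
* `cor312_iff`, `display_iff` — likewise for `Cor312` and `Display`;
* `multiradialEstimate_of_proofData` — **the skeleton's hypothesis `MultiradialEstimate` is DISCHARGED
  modulo `ProofData` + `IsEtaPrm η_prm`**: it is no longer a posited real inequality but the kernel-checked
  consequence of six named, printed, finer inequalities (each attributable to Prop. 1.3, 1.4, 1.5, 1.8 or to
  the definition of `𝔰^≤`), plus the (proved) prime number theorem;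
* `display_of_proofData_of_cor312` — hence `ProofData → IsEtaPrm η_prm → Cor312 → Display` for `l ≥ 7`
  (the skeleton's `display_of_cor312` with its first hypothesis discharged).

What remains HYPOTHETICAL on Mochizuki's branch of the fork after this file: `Cor312` itself (the disputed
statement) and the six `ProofData` fields (campaign work: S1/S2/c312-3 discharge them from real
definitions). Deliberately NOT here: any judgement; the construction of initial Θ-data (Cor. 2.2).
-/

noncomputable section

namespace Summit.ABC

namespace IUTFork

open Literature.IUT.LogVolume

/-- The skeleton's `Thm110Data` determined by Literature-side numerics `X` with `l ≥ 7` (the printed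
`l ≠ 5`): same `l`, `d_mod`, `η_prm`, `log(q)`, `−|log(Θ)|`; `estar := e*_mod` (cast to `ℝ`);
`logdf := log(𝔡^{F_tpd}) + log(𝔣^{F_tpd})`. [claim: Mochizuki2012, status: disputed] -/
def toThm110Data (X : Thm110Numerics) (h7 : 7 ≤ X.l) : Thm110Data where
  l := X.l
  seven_le_l := h7
  dmod := X.dmod
  one_le_dmod := X.one_le_dmod
  estar := (X.estar : ℝ)
  estar_nonneg := by positivity
  eta := X.etaPrm
  eta_nonneg := X.etaPrm_pos.le
  logdf := X.logDiffTpd + X.logCondTpd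
  logdf_nonneg := add_nonneg X.logDiffTpd_nonneg X.logCondTpd_nonneg
  logq := X.logq
  logq_pos := X.logq_pos
  negLogTheta := X.negLogTheta

variable (X : Thm110Numerics) (h7 : 7 ≤ X.l)

/-- Same `|log(q)| = (1/2l)·log(q)`. [claim: Mochizuki2012, status: disputed] -/
theorem toThm110Data_absLogq : (toThm110Data X h7).absLogq = X.absLogq := rfl

/-- Same braces. [claim: Mochizuki2012, status: disputed] -/
theorem toThm110Data_bracket : (toThm110Data X h7).bracket = X.bracket := rfl

/-- Same printed `C_Θ`. [claim: Mochizuki2012, status: disputed] -/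
theorem toThm110Data_CTheta : (toThm110Data X h7).CTheta = X.CTheta := rfl

/-- The skeleton's hypothesis `MultiradialEstimate` ("`−|log(Θ)| ≤ C_Θ·|log(q)|`") is literally the
Literature-side `CThetaAdmissible`. [claim: Mochizuki2012, status: disputed] -/
theorem multiradialEstimate_iff : (toThm110Data X h7).MultiradialEstimate ↔ X.CThetaAdmissible := Iff.rfl

/-- The skeleton's hypothesis `Cor312` is literally the Literature-side `Cor312`.
[claim: Mochizuki2012, status: disputed] -/
theorem cor312_iff : (toThm110Data X h7).Cor312 ↔ X.Cor312 := Iff.rfl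

/-- The skeleton's `Display` is literally the Literature-side `Display` (first displayed conclusion of
Theorem 1.10). [claim: Mochizuki2012, status: disputed] -/
theorem display_iff : (toThm110Data X h7).Display ↔ X.Display := by
  unfold Thm110Data.Display Thm110Numerics.Display
  simp only [toThm110Data]
  constructor <;> intro h <;> linarith

/-- **The skeleton's `MultiradialEstimate` DISCHARGED modulo the printed finer inputs**: for numerics `X`
with proof data `P` ([IUTchIV] Thm 1.10, Steps (ii)–(vii) inputs as printed) and `η_prm` the positive real
number of Prop. 1.6, `−|log(Θ)| ≤ C_Θ·|log(q)|` holds for the printed `C_Θ` — by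
`Thm110Numerics.cThetaAdmissible_of_proofData` (Steps (i)–(iii), (viii) kernel-checked).
[claim: Mochizuki2012, status: disputed] -/
theorem multiradialEstimate_of_proofData (P : X.ProofData) (hη : IsEtaPrm X.etaPrm) :
    (toThm110Data X h7).MultiradialEstimate :=
  (multiradialEstimate_iff X h7).mpr (Thm110Numerics.cThetaAdmissible_of_proofData P hη)

/-- Mochizuki's branch of the fork with one hypothesis fewer: `ProofData → IsEtaPrm η_prm → Cor312 →
Display` (the skeleton's `display_of_cor312` with `MultiradialEstimate` supplied by the Literature proof).
`Cor312` — the disputed statement — remains the hypothesis. [claim: Mochizuki2012, status: disputed] -/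
theorem display_of_proofData_of_cor312 (P : X.ProofData) (hη : IsEtaPrm X.etaPrm)
    (hcor : (toThm110Data X h7).Cor312) : (toThm110Data X h7).Display :=
  (toThm110Data X h7).display_of_cor312 (multiradialEstimate_of_proofData X h7 P hη) hcor

/-- There exists an admissible `η_prm` (the prime number theorem is a theorem of the tree), so the
`IsEtaPrm` hypothesis is about WHICH constant is called `η_prm`, not an assumption on the world.
[claim: Mochizuki2012, status: disputed] -/
theorem exists_etaPrm : ∃ η : ℝ, IsEtaPrm η := exists_isEtaPrm

end IUTFork

end Summit.ABC

end
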